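import Summits.CriticalPhenomena.CardyFormulaZ2.Theses.CardySelfRefinement
import Literature.Probability.RandomPlanarGeometry.SLEUniquenessInLaw
import Literature.Probability.LatticeModels.MedialInterfaceMeasurability

/-!
# `SubseqUpgrade` (stmt-CriticalPhenomena-10279), negative side III: which mesh sets must be
# controlled (a dichotomy), the weakest form of (H2), and (H1) is free

Negative-side support for the crux `CardySelfRefinement.SubseqUpgrade` (cdisprove unit, cycle 3;
companions `SubseqPrincipleNeedsUniqueness.lean`, `StubsLoadBearingAndConverse.lean`; work file
`Cruxes/SubseqUpgrade/Disproof.lean`). The crux is NOT refuted — it is a theorem. This file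
records, sorry-free and definition-free, the exact boundary of its hypotheses:

* `tendstoLaw_iff_forall_seq_exists_mem` — **the weakest subsequence principle, an
  equivalence**: `TendstoLaw Y P Z P'` holds iff for every test function `f`, every
  neighbourhood `U` of the limit statistic and every everywhere-positive null sequence of meshes,
  SOME mesh of the sequence has its `f`-statistic in `U`. No subsequence, no monotonicity of the
  reindexing, no simultaneity in `f`: the extraction clause of hypothesis (H2) of the crux
  carries no content at all — all content is the identification of the limit values;
* `tendstoLaw_of_hits_on` — moreover only STRICTLY DECREASING sequences with values in a fixed
  right-neighbourhood `T ∈ 𝓝[>] 0` of `0` need to be controlled (`exists_strictAnti_subseq`: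
  every positive null sequence has a strictly decreasing subsequence, infinitary
  Erdős–Szekeres);
* `not_lawCriterion_on_of_not_mem_nhdsWithin` — conversely, for ANY set of meshes `T ∉ 𝓝[>] 0`
  the law criterion restricted to `T`-valued sequences is FALSE, even in its strongest form (one
  `StrictMono` subsequence serving all test functions); with the previous item this is a
  DICHOTOMY: the mesh sequences with values in `T` suffice iff `T ∈ 𝓝[>] 0`;
  `not_mem_nhdsWithin_Ioi_of_countable` — in particular NO COUNTABLE set of meshes suffices
  (`not_lawCriterion_on_of_countable`, `not_lawCriterion_on_range`: not the values of any single
  sequence, e.g. `1/(m+1)` or `2⁻ⁿ`), sharpening `not_lawCriterion_onMesh`;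
* `measurable_bondInterfaceIn_all`, `subseqUpgrade_h1` — hypothesis (H1) of the crux (eventual
  a.e.-measurability of the bond interface) is a THEOREM, unconditionally in `D`, `E`, `δ`
  (factorisation through the countable medial exploration,
  `measurable_of_medialExploration`): the crux is `(H2) → conclusion` in substance, and
  `subseqUpgrade_h2Hit_iff_concl` — (H2) in its weakest ("hit") form is EQUIVALENT to the
  conclusion modulo an SLE₆ law in every Dobrushin domain; `concl_of_h2Hit_on` — the directly
  consumable strengthened crux: hits along STRICTLY DECREASING mesh sequences in `(0, ε)` only.
-/

noncomputable section

namespace Summit.CriticalPhenomena.CardyFormulaZ2.Theorems.SubseqUpgrade.Negative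

open Filter MeasureTheory Topology
open scoped NNReal BoundedContinuousFunction
open Literature.Probability.RandomPlanarGeometry Literature.Probability.LatticeModels
  Literature.Probability.Percolation

/-! ## The weakest subsequence principle: hits suffice, and are necessary -/

/-- **`TendstoLaw` ⟺ every positive null mesh sequence hits every neighbourhood of the limit
statistic.** For every bounded continuous `f`, every `U ∈ 𝓝 (∫ f (Z ·) dP')` and every
everywhere-positive null sequence `s`, some index `n` has `∫ f (Y (s n) ·) dP (s n) ∈ U`. The
forward direction is trivial; the converse is the contrapositive of the definition of the limit
along the countably generated filter `𝓝[>] 0` (`exists_seq_forall_of_frequently`). Hence in any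
subsequence principle for `TendstoLaw` the reindexing map may be ARBITRARY (not `StrictMono`, not
even tending to `∞`) and may depend on `f`. Billingsley (1999), Thm. 2.6. [folklore] -/
theorem tendstoLaw_iff_forall_seq_exists_mem {Ωδ : ℝ → Type*} [∀ δ, MeasurableSpace (Ωδ δ)]
    {Ω' : Type*} [MeasurableSpace Ω'] {X : Type*} [TopologicalSpace X]
    (Y : ∀ δ, Ωδ δ → X) (P : ∀ δ, Measure (Ωδ δ)) (Z : Ω' → X) (P' : Measure Ω') :
    TendstoLaw Y P Z P' ↔
      ∀ f : X →ᵇ ℝ, ∀ U ∈ 𝓝 (∫ ω, f (Z ω) ∂P'), ∀ s : ℕ → ℝ, (∀ n, 0 < s n) →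
        Tendsto s atTop (𝓝 0) → ∃ n, (∫ ω, f (Y (s n) ω) ∂P (s n)) ∈ U := by
  constructor
  · intro h f U hU s hs hs0
    have hs' : Tendsto s atTop (𝓝[>] (0 : ℝ)) :=
      tendsto_nhdsWithin_iff.2 ⟨hs0, Eventually.of_forall fun n => Set.mem_Ioi.2 (hs n)⟩
    exact (((h f).comp hs').eventually_mem hU).exists
  · intro h f
    by_contra hnot
    rw [tendsto_iff_forall_eventually_mem] at hnot
    simp only [not_forall] at hnot
    obtain ⟨U, hU, hfreq⟩ := hnot
    have hfr : ∃ᶠ δ in 𝓝[>] (0 : ℝ), (∫ ω, f (Y δ ω) ∂P δ) ∉ U ∧ δ ∈ Set.Ioi (0 : ℝ) :=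
      (not_eventually.1 hfreq).and_eventually eventually_mem_nhdsWithin
    obtain ⟨ns, hns, hboth⟩ := exists_seq_forall_of_frequently hfr
    obtain ⟨n, hn⟩ := h f U hU ns (fun n => (hboth n).2) (tendsto_nhds_of_tendsto_nhdsWithin hns)
    exact (hboth n).1 hn

/-- **Every everywhere-positive null sequence has a strictly decreasing subsequence** (infinitary
Erdős–Szekeres, `exists_increasing_or_nonincreasing_subseq'`: the other alternative, a
non-decreasing subsequence, is impossible for a positive sequence tending to `0`). [folklore] -/
theorem exists_strictAnti_subseq {s : ℕ → ℝ} (hs : ∀ n, 0 < s n)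
    (hs0 : Tendsto s atTop (𝓝 0)) : ∃ g : ℕ → ℕ, StrictMono g ∧ StrictAnti (s ∘ g) := by
  obtain ⟨g, h | h⟩ := exists_increasing_or_nonincreasing_subseq' (fun a b : ℝ => b < a) s
  · exact ⟨g, g.strictMono, strictAnti_nat_of_succ_lt fun n => h n⟩
  · exfalso
    have hle : ∀ n, s (g 0) ≤ s (g (n + 1)) := fun n => not_lt.1 (h 0 (n + 1) n.succ_pos)
    have hlim : Tendsto (fun n => s (g (n + 1))) atTop (𝓝 0) :=
      (hs0.comp g.strictMono.tendsto_atTop).comp (tendsto_add_atTop_nat 1)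
    have hev := hlim.eventually (gt_mem_nhds (hs (g 0)))
    obtain ⟨n, hn⟩ := hev.exists
    exact (not_lt.2 (hle n)) hn

/-- A sequence tending to `0` within `(0, ∞)` is eventually inside any `T ∈ 𝓝[>] 0` and has a
STRICTLY DECREASING subsequence with all its values in `T`. [folklore] -/
theorem exists_strictAnti_subseq_mem {T : Set ℝ} (hT : T ∈ 𝓝[>] (0 : ℝ)) {ns : ℕ → ℝ}
    (hns : Tendsto ns atTop (𝓝[>] (0 : ℝ))) :
    ∃ g : ℕ → ℕ, StrictMono g ∧ StrictAnti (ns ∘ g) ∧ (∀ n, ns (g n) ∈ T) ∧ ∀ n, 0 < ns (g n) := by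
  have hev : ∀ᶠ n in atTop, ns n ∈ T ∧ ns n ∈ Set.Ioi (0 : ℝ) :=
    (hns.eventually_mem hT).and (hns.eventually_mem self_mem_nhdsWithin)
  obtain ⟨N, hN⟩ := eventually_atTop.1 hev
  have hpos : ∀ n, 0 < ns (n + N) := fun n => (hN _ (Nat.le_add_left N n)).2
  have hlim : Tendsto (fun n => ns (n + N)) atTop (𝓝 0) :=
    (tendsto_nhds_of_tendsto_nhdsWithin hns).comp (tendsto_add_atTop_nat N)
  obtain ⟨g, hg, hanti⟩ := exists_strictAnti_subseq hpos hlim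
  refine ⟨fun n => g n + N, fun a b hab => Nat.add_lt_add_right (hg hab) N, hanti,
    fun n => (hN _ (Nat.le_add_left N (g n))).1, fun n => hpos (g n)⟩

/-- **Strictly decreasing sequences inside a right-neighbourhood of `0` suffice** (the sharpest
sufficient class of mesh sequences, in the weakest "hit" form): if `T ∈ 𝓝[>] 0` and every
strictly decreasing, `T`-valued, everywhere-positive null sequence hits every neighbourhood of
the limit statistic of every test function, then `TendstoLaw Y P Z P'`. So an upstream discharge
of hypothesis (H2) of the crux may assume the mesh sequence strictly decreasing and below any
fixed `ε`. Billingsley (1999), Thm. 2.6. [folklore] -/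
theorem tendstoLaw_of_hits_on {Ωδ : ℝ → Type*} [∀ δ, MeasurableSpace (Ωδ δ)]
    {Ω' : Type*} [MeasurableSpace Ω'] {X : Type*} [TopologicalSpace X]
    {Y : ∀ δ, Ωδ δ → X} {P : ∀ δ, Measure (Ωδ δ)} {Z : Ω' → X} {P' : Measure Ω'}
    {T : Set ℝ} (hT : T ∈ 𝓝[>] (0 : ℝ))
    (h : ∀ f : X →ᵇ ℝ, ∀ U ∈ 𝓝 (∫ ω, f (Z ω) ∂P'), ∀ s : ℕ → ℝ, StrictAnti s →
      (∀ n, s n ∈ T) → (∀ n, 0 < s n) → Tendsto s atTop (𝓝 0) →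
        ∃ n, (∫ ω, f (Y (s n) ω) ∂P (s n)) ∈ U) :
    TendstoLaw Y P Z P' := by
  refine (tendstoLaw_iff_forall_seq_exists_mem Y P Z P').2 fun f U hU s hs hs0 => ?_
  have hs' : Tendsto s atTop (𝓝[>] (0 : ℝ)) :=
    tendsto_nhdsWithin_iff.2 ⟨hs0, Eventually.of_forall fun n => Set.mem_Ioi.2 (hs n)⟩
  obtain ⟨g, hg, hanti, hmem, hpos⟩ := exists_strictAnti_subseq_mem hT hs'
  obtain ⟨n, hn⟩ := h f U hU (s ∘ g) hanti hmem hpos (hs0.comp hg.tendsto_atTop)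
  exact ⟨g n, hn⟩

/-- The subsequence form: the law criterion with its hypothesis asked only of strictly
decreasing `T`-valued sequences, `T ∈ 𝓝[>] 0` (and an arbitrary, possibly `f`-dependent
reindexing). [folklore] -/
theorem tendstoLaw_of_subseq_on {Ωδ : ℝ → Type*} [∀ δ, MeasurableSpace (Ωδ δ)]
    {Ω' : Type*} [MeasurableSpace Ω'] {X : Type*} [TopologicalSpace X]
    {Y : ∀ δ, Ωδ δ → X} {P : ∀ δ, Measure (Ωδ δ)} {Z : Ω' → X} {P' : Measure Ω'}
    {T : Set ℝ} (hT : T ∈ 𝓝[>] (0 : ℝ))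
    (h : ∀ s : ℕ → ℝ, StrictAnti s → (∀ n, s n ∈ T) → (∀ n, 0 < s n) →
      Tendsto s atTop (𝓝 0) → ∀ f : X →ᵇ ℝ, ∃ φ : ℕ → ℕ,
        Tendsto (fun n ↦ ∫ ω, f (Y (s (φ n)) ω) ∂P (s (φ n))) atTop (𝓝 (∫ ω, f (Z ω) ∂P'))) :
    TendstoLaw Y P Z P' := by
  refine tendstoLaw_of_hits_on hT fun f U hU s hanti hmem hs hs0 => ?_
  obtain ⟨φ, hφ⟩ := h s hanti hmem hs hs0 f
  obtain ⟨n, hn⟩ := (hφ.eventually_mem hU).exists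
  exact ⟨φ n, hn⟩

/-! ## The dichotomy: mesh sets `T ∉ 𝓝[>] 0` never suffice -/

/-- **No set of meshes which is not a right-neighbourhood of `0` suffices.** For `T ∉ 𝓝[>] 0`
the law criterion with its hypothesis restricted to `T`-valued sequences is FALSE, even in the
strongest form of the hypothesis (one `StrictMono` subsequence serving all test functions).
Witness: `Unit` configuration spaces with Dirac laws, the deterministic real "interface"
`T.indicator 1` and limit `Z = 1`: along `T`-valued sequences the laws are constantly `δ_1`, but
`T ∉ 𝓝[>] 0` yields a sequence `ns → 0⁺` avoiding `T` (`exists_seq_forall_of_frequently`), along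
which they are `δ_0`. With `tendstoLaw_of_subseq_on` this is a dichotomy: `T`-valued sequences
suffice iff `T ∈ 𝓝[>] 0`. [folklore] -/
theorem not_lawCriterion_on_of_not_mem_nhdsWithin {T : Set ℝ} (hT : T ∉ 𝓝[>] (0 : ℝ)) :
    ¬ ∀ {Ωδ : ℝ → Type} [∀ δ, MeasurableSpace (Ωδ δ)] {Ω' : Type} [MeasurableSpace Ω']
        {X : Type} [TopologicalSpace X]
        (Y : ∀ δ, Ωδ δ → X) (P : ∀ δ, Measure (Ωδ δ)) (Z : Ω' → X) (P' : Measure Ω'),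
        (∀ s : ℕ → ℝ, (∀ n, s n ∈ T) → (∀ n, 0 < s n) → Tendsto s atTop (𝓝 0) →
            ∃ φ : ℕ → ℕ, StrictMono φ ∧ ∀ f : X →ᵇ ℝ,
              Tendsto (fun n ↦ ∫ ω, f (Y (s (φ n)) ω) ∂P (s (φ n))) atTop
                (𝓝 (∫ ω, f (Z ω) ∂P'))) →
          TendstoLaw Y P Z P' := by
  intro h
  -- a bounded continuous test function on `ℝ` with `g 0 = 0`, `g 1 = 1` (the clamp)
  obtain ⟨g, hg0, hg1⟩ : ∃ g : ℝ →ᵇ ℝ, g 0 = 0 ∧ g 1 = 1 :=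
    ⟨BoundedContinuousFunction.ofNormedAddCommGroup (fun x : ℝ => max 0 (min 1 x))
      (continuous_const.max (continuous_const.min continuous_id)) 1 fun x => by
        rw [Real.norm_eq_abs, abs_le]
        exact ⟨by linarith [le_max_left (0 : ℝ) (min 1 x)], max_le zero_le_one (min_le_left _ _)⟩,
      by simp, by simp⟩
  -- a sequence `ns → 0⁺` avoiding `T`
  have hfr : ∃ᶠ δ in 𝓝[>] (0 : ℝ), δ ∉ T := not_eventually.1 (mt eventually_mem_set.1 hT)
  obtain ⟨ns, hns, hnsT⟩ := exists_seq_forall_of_frequently hfr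
  have key := @h (fun _ => Unit) (fun _ => inferInstance) Unit _ ℝ _
    (fun δ _ => T.indicator (1 : ℝ → ℝ) δ) (fun _ => Measure.dirac ()) (fun _ => (1 : ℝ))
    (Measure.dirac ()) ?_
  · have h0 : Tendsto (fun _ : ℕ => (0 : ℝ)) atTop (𝓝 (∫ _ω : Unit, g 1 ∂Measure.dirac ())) :=
      ((key g).comp hns).congr fun n => by
        show (∫ _ω : Unit, g (T.indicator 1 (ns n)) ∂Measure.dirac ()) = 0
        rw [Set.indicator_of_notMem (hnsT n), integral_dirac, hg0]
    rw [integral_dirac, hg1] at h0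
    exact one_ne_zero (tendsto_nhds_unique h0 tendsto_const_nhds)
  · intro s hs _ _
    refine ⟨id, strictMono_id, fun f => ?_⟩
    refine (tendsto_const_nhds (x := ∫ _ω : Unit, f 1 ∂Measure.dirac ())).congr fun n => ?_
    show _ = ∫ _ω : Unit, f (T.indicator 1 (s n)) ∂Measure.dirac ()
    rw [Set.indicator_of_mem (hs n)]
    rfl

/-- A countable set of reals is not a right-neighbourhood of `0`: such a neighbourhood contains
an interval `(0, u)`, `u > 0`, which is uncountable (`Cardinal.Real.Ioo_countable_iff`). [folklore] -/
theorem not_mem_nhdsWithin_Ioi_of_countable {T : Set ℝ} (hT : T.Countable) :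
    T ∉ 𝓝[>] (0 : ℝ) := by
  intro h
  obtain ⟨u, hu, hsub⟩ := mem_nhdsGT_iff_exists_Ioo_subset.1 h
  have hc : (Set.Ioo (0 : ℝ) u).Countable := hT.mono hsub
  rw [Cardinal.Real.Ioo_countable_iff] at hc
  exact absurd hc (not_le.2 hu)

/-- **No countable set of meshes suffices**: for countable `T` the law criterion restricted to
`T`-valued mesh sequences is false. Hypothesis (H2) of the crux needs a continuum of meshes.
[folklore] -/
theorem not_lawCriterion_on_of_countable {T : Set ℝ} (hT : T.Countable) :
    ¬ ∀ {Ωδ : ℝ → Type} [∀ δ, MeasurableSpace (Ωδ δ)] {Ω' : Type} [MeasurableSpace Ω']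
        {X : Type} [TopologicalSpace X]
        (Y : ∀ δ, Ωδ δ → X) (P : ∀ δ, Measure (Ωδ δ)) (Z : Ω' → X) (P' : Measure Ω'),
        (∀ s : ℕ → ℝ, (∀ n, s n ∈ T) → (∀ n, 0 < s n) → Tendsto s atTop (𝓝 0) →
            ∃ φ : ℕ → ℕ, StrictMono φ ∧ ∀ f : X →ᵇ ℝ,
              Tendsto (fun n ↦ ∫ ω, f (Y (s (φ n)) ω) ∂P (s (φ n))) atTop
                (𝓝 (∫ ω, f (Z ω) ∂P'))) →
          TendstoLaw Y P Z P' :=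
  not_lawCriterion_on_of_not_mem_nhdsWithin (not_mem_nhdsWithin_Ioi_of_countable hT)

/-- **The values of one mesh sequence never suffice** (e.g. `δ = 1/(m+1)`, `δ = 2⁻ⁿ`, or all
subsequences of any fixed sequence): the range of a sequence is countable. Generalises
`not_lawCriterion_onMesh`. [folklore] -/
theorem not_lawCriterion_on_range (u : ℕ → ℝ) :
    ¬ ∀ {Ωδ : ℝ → Type} [∀ δ, MeasurableSpace (Ωδ δ)] {Ω' : Type} [MeasurableSpace Ω']
        {X : Type} [TopologicalSpace X]
        (Y : ∀ δ, Ωδ δ → X) (P : ∀ δ, Measure (Ωδ δ)) (Z : Ω' → X) (P' : Measure Ω'),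
        (∀ s : ℕ → ℝ, (∀ n, s n ∈ Set.range u) → (∀ n, 0 < s n) → Tendsto s atTop (𝓝 0) →
            ∃ φ : ℕ → ℕ, StrictMono φ ∧ ∀ f : X →ᵇ ℝ,
              Tendsto (fun n ↦ ∫ ω, f (Y (s (φ n)) ω) ∂P (s (φ n))) atTop
                (𝓝 (∫ ω, f (Z ω) ∂P'))) →
          TendstoLaw Y P Z P' :=
  not_lawCriterion_on_of_countable (Set.countable_range u)

/-! ## (H1) is free: the bond interface is measurable, unconditionally -/

/-- **The bond interface is Borel measurable**, for every Dobrushin domain `D` and EVERY discrete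
Dobrushin domain `E` (no admissibility, finiteness or positive-mesh hypothesis): it is a function
of the medial exploration `medialExploration E ω`, a measurable map into a countable discrete
space (`measurable_of_medialExploration`). Aizenman–Burchard (1999), §2.1. [folklore] -/
theorem measurable_bondInterfaceIn_all (D : DobrushinDomain) (E : DiscreteDobrushin) :
    Measurable (bondInterfaceIn D E) :=
  measurable_of_medialExploration E fun ω ω' h => by
    rw [bondInterfaceIn_apply, bondInterfaceIn_apply, medialExplorationCurve_congr h]

/-- **Hypothesis (H1) of `SubseqUpgrade` is a theorem** (verbatim; the discretisation-family
hypothesis is not even used). So the crux is `(H2) → conclusion` in substance, and the upstream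
item `LagHandOff` owes only (H2). [folklore] -/
theorem subseqUpgrade_h1 :
    ∀ (D : DobrushinDomain) (E : ℝ → DiscreteDobrushin), ZdDiscretisationFamily D E →
      ∀ᶠ δ in 𝓝[>] (0 : ℝ), AEMeasurable (bondInterfaceIn D (E δ))
        (bondPercolation (zdGraph 2) half) :=
  fun D E _ => Eventually.of_forall fun δ => (measurable_bondInterfaceIn_all D (E δ)).aemeasurable

/-! ## The weakest hypothesis for the crux: SLE₆ hits, and their necessity -/

/-- **The crux from hits alone.** If for every everywhere-positive null mesh sequence there is a
family of chordal SLE₆ laws such that, for every admissible `(D, E)`, every test function `f`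
and every `ε > 0`, SOME mesh of the sequence has its `f`-statistic `ε`-close to the SLE₆ value,
then the interface converges in law to chordal SLE₆ for every admissible `(D, E)`. Compared with
hypothesis (H2) of `SubseqUpgrade`: no (H1) (it is `subseqUpgrade_h1`), no subsequence, no
`StrictMono`, no simultaneity in `f` or in `(D, E)` beyond the choice of the SLE₆ family (which
uniqueness `IsSLELaw.eq_map_of_isSLECurve` makes immaterial). [folklore] -/
theorem concl_of_h2Hit
    (h : ∀ δs : ℕ → ℝ, (∀ n, 0 < δs n) → Tendsto δs atTop (𝓝 0) →
      ∃ P : ChordalFamily, (∀ D : DobrushinDomain, IsSLELaw 6 D (P D)) ∧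
        ∀ (D : DobrushinDomain) (E : ℝ → DiscreteDobrushin), ZdDiscretisationFamily D E →
          ∀ f : CurveClass ℂ →ᵇ ℝ, ∀ ε > (0 : ℝ), ∃ n,
            |(∫ ω, f (bondInterfaceIn D (E (δs n)) ω) ∂(bondPercolation (zdGraph 2) half)) -
              ∫ γ, f γ ∂(P D)| < ε) :
    ∀ (D : DobrushinDomain) (E : ℝ → DiscreteDobrushin), ZdDiscretisationFamily D E →
      ConvergesInLawToSLE 6 D (Ωδ := fun _ => BondConfig (Site 2))
        (fun δ => bondInterfaceIn D (E δ)) (fun _ => bondPercolation (zdGraph 2) half) := by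
  intro D E hDE
  obtain ⟨P₀, hP₀, -⟩ := h (fun n => 1 / ((n : ℝ) + 1)) (fun n => by positivity)
    tendsto_one_div_add_atTop_nhds_zero_nat
  obtain ⟨Γ, hΓ, -⟩ := hP₀ D
  refine ⟨Γ, hΓ, subseqUpgrade_h1 D E hDE, ?_⟩
  refine (tendstoLaw_iff_forall_seq_exists_mem _ _ _ _).2 fun f U hU s hs hs0 => ?_
  obtain ⟨P, hP, hhit⟩ := h s hs hs0
  obtain ⟨ε, hε, hball⟩ := Metric.mem_nhds_iff.1 hU
  obtain ⟨n, hn⟩ := hhit D E hDE f ε hε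
  refine ⟨n, hball ?_⟩
  rw [Metric.mem_ball, Real.dist_eq,
    ← integral_map hΓ.aemeasurable f.continuous.aestronglyMeasurable,
    ← (hP D).eq_map_of_isSLECurve hΓ]
  exact hn

/-- **The crux from hits along strictly decreasing meshes below `ε` only** (the directly
consumable strengthening for the upstream discharge of (H2)): it suffices that for every
STRICTLY DECREASING mesh sequence with values in `(0, ε)` there is a family of chordal SLE₆ laws
whose `f`-statistics are hit `ε'`-closely at some mesh of the sequence, for every admissible
`(D, E)`, every `f` and every `ε' > 0`. (`tendstoLaw_of_hits_on` with `T = Set.Ioo 0 ε`; the SLE₆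
curve of `D` is read off at the sequence `ε/(n+2)`.) [folklore] -/
theorem concl_of_h2Hit_on {ε : ℝ} (hε : 0 < ε)
    (h : ∀ δs : ℕ → ℝ, StrictAnti δs → (∀ n, δs n ∈ Set.Ioo 0 ε) → (∀ n, 0 < δs n) →
      Tendsto δs atTop (𝓝 0) →
      ∃ P : ChordalFamily, (∀ D : DobrushinDomain, IsSLELaw 6 D (P D)) ∧
        ∀ (D : DobrushinDomain) (E : ℝ → DiscreteDobrushin), ZdDiscretisationFamily D E →
          ∀ f : CurveClass ℂ →ᵇ ℝ, ∀ ε' > (0 : ℝ), ∃ n,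
            |(∫ ω, f (bondInterfaceIn D (E (δs n)) ω) ∂(bondPercolation (zdGraph 2) half)) -
              ∫ γ, f γ ∂(P D)| < ε') :
    ∀ (D : DobrushinDomain) (E : ℝ → DiscreteDobrushin), ZdDiscretisationFamily D E →
      ConvergesInLawToSLE 6 D (Ωδ := fun _ => BondConfig (Site 2))
        (fun δ => bondInterfaceIn D (E δ)) (fun _ => bondPercolation (zdGraph 2) half) := by
  intro D E hDE
  -- the SLE₆ curve of `D`, from the strictly decreasing sequence `ε / (n + 2)` in `(0, ε)`
  have h2pos : ∀ n : ℕ, (0 : ℝ) < (n : ℝ) + 2 := fun n => by positivity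
  have hanti0 : StrictAnti fun n : ℕ => ε / ((n : ℝ) + 2) := fun a b hab =>
    div_lt_div_of_pos_left hε (h2pos a) (by exact_mod_cast Nat.add_lt_add_right hab 2)
  have hmem0 : ∀ n : ℕ, ε / ((n : ℝ) + 2) ∈ Set.Ioo 0 ε := fun n =>
    ⟨div_pos hε (h2pos n), (div_lt_self hε (by linarith))⟩
  have hlim0 : Tendsto (fun n : ℕ => ε / ((n : ℝ) + 2)) atTop (𝓝 0) :=
    tendsto_const_nhds.div_atTop (tendsto_atTop_add_const_right _ _ tendsto_natCast_atTop_atTop)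
  obtain ⟨P₀, hP₀, -⟩ := h _ hanti0 hmem0 (fun n => (hmem0 n).1) hlim0
  obtain ⟨Γ, hΓ, -⟩ := hP₀ D
  refine ⟨Γ, hΓ, subseqUpgrade_h1 D E hDE, ?_⟩
  refine tendstoLaw_of_hits_on (Ioo_mem_nhdsGT hε) fun f U hU s hanti hmem hs hs0 => ?_
  obtain ⟨P, hP, hhit⟩ := h s hanti hmem hs hs0
  obtain ⟨ε', hε', hball⟩ := Metric.mem_nhds_iff.1 hU
  obtain ⟨n, hn⟩ := hhit D E hDE f ε' hε'
  refine ⟨n, hball ?_⟩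
  rw [Metric.mem_ball, Real.dist_eq,
    ← integral_map hΓ.aemeasurable f.continuous.aestronglyMeasurable,
    ← (hP D).eq_map_of_isSLECurve hΓ]
  exact hn

/-- **Necessity of the hits** (converse, modulo an SLE₆ law in every Dobrushin domain, cf.
`forall_exists_isSLELaw_six`): the conclusion of the crux implies the hit form of (H2), with one
chordal family for all sequences. So the hit form is the weakest possible hypothesis and the
crux, in substance, an equivalence `(H2-hit) ⟺ conclusion`. [folklore] -/
theorem h2Hit_of_concl
    (hex : ∀ D : DobrushinDomain, ∃ μ : Measure (CurveClass ℂ), IsSLELaw 6 D μ)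
    (hC : ∀ (D : DobrushinDomain) (E : ℝ → DiscreteDobrushin), ZdDiscretisationFamily D E →
      ConvergesInLawToSLE 6 D (Ωδ := fun _ => BondConfig (Site 2))
        (fun δ => bondInterfaceIn D (E δ)) (fun _ => bondPercolation (zdGraph 2) half)) :
    ∀ δs : ℕ → ℝ, (∀ n, 0 < δs n) → Tendsto δs atTop (𝓝 0) →
      ∃ P : ChordalFamily, (∀ D : DobrushinDomain, IsSLELaw 6 D (P D)) ∧
        ∀ (D : DobrushinDomain) (E : ℝ → DiscreteDobrushin), ZdDiscretisationFamily D E →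
          ∀ f : CurveClass ℂ →ᵇ ℝ, ∀ ε > (0 : ℝ), ∃ n,
            |(∫ ω, f (bondInterfaceIn D (E (δs n)) ω) ∂(bondPercolation (zdGraph 2) half)) -
              ∫ γ, f γ ∂(P D)| < ε := by
  choose Pfam hPfam using hex
  intro δs hpos hlim
  refine ⟨Pfam, hPfam, fun D E hDE f ε hε => ?_⟩
  obtain ⟨Γ, hΓ, -, hT⟩ := hC D E hDE
  have hδ : Tendsto δs atTop (𝓝[>] (0 : ℝ)) :=
    tendsto_nhdsWithin_iff.2 ⟨hlim, Eventually.of_forall fun n => Set.mem_Ioi.2 (hpos n)⟩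
  have hlimf := (hT f).comp hδ
  rw [← integral_map hΓ.aemeasurable f.continuous.aestronglyMeasurable,
    ← (hPfam D).eq_map_of_isSLECurve hΓ] at hlimf
  obtain ⟨n, hn⟩ := ((Metric.tendsto_atTop.1 hlimf) ε hε)
  exact ⟨n, by simpa [Real.dist_eq] using hn n le_rfl⟩

/-- **The crux in substance is an equivalence** `(H2-hit) ⟺ conclusion`, modulo an SLE₆ law in
every Dobrushin domain. [folklore] -/
theorem subseqUpgrade_h2Hit_iff_concl
    (hex : ∀ D : DobrushinDomain, ∃ μ : Measure (CurveClass ℂ), IsSLELaw 6 D μ) :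
    (∀ δs : ℕ → ℝ, (∀ n, 0 < δs n) → Tendsto δs atTop (𝓝 0) →
      ∃ P : ChordalFamily, (∀ D : DobrushinDomain, IsSLELaw 6 D (P D)) ∧
        ∀ (D : DobrushinDomain) (E : ℝ → DiscreteDobrushin), ZdDiscretisationFamily D E →
          ∀ f : CurveClass ℂ →ᵇ ℝ, ∀ ε > (0 : ℝ), ∃ n,
            |(∫ ω, f (bondInterfaceIn D (E (δs n)) ω) ∂(bondPercolation (zdGraph 2) half)) -
              ∫ γ, f γ ∂(P D)| < ε) ↔
    ∀ (D : DobrushinDomain) (E : ℝ → DiscreteDobrushin), ZdDiscretisationFamily D E →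
      ConvergesInLawToSLE 6 D (Ωδ := fun _ => BondConfig (Site 2))
        (fun δ => bondInterfaceIn D (E δ)) (fun _ => bondPercolation (zdGraph 2) half) :=
  ⟨concl_of_h2Hit, h2Hit_of_concl hex⟩

end Summit.CriticalPhenomena.CardyFormulaZ2.Theorems.SubseqUpgrade.Negative

end
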